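import Literature.Analysis.Fourier.StationaryPhaseLog
import HarnessLib

/-!
# Oscillatory integrals with a smooth amplitude: stationary phase, the near-endpoint case, and tails

Topic `Literature/Analysis/Fourier`, sequel to `StationaryPhaseLog.lean`.  Everything here is PROVED;
no definitions, no named facts.  These are the three estimates for `∫_α^β g(x) e^{iP(x)} dx` with an
amplitude `g` vanishing at the end-points that the weighted van der Corput `B`-process (Poisson summation
along a line followed by stationary phase) consumes:

* `integral_amp_mul_exp_eq_parts` — the integration-by-parts identity
  `∫_α^β h e^{iP} = -i[h e^{iP}/P']_α^β + i ∫_α^β (h'/P' - hP''/P'²) e^{iP}` (`P' ≠ 0`);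
* `norm_integral_amp_right_le` / `norm_integral_amp_left_le` — **one-sided first-derivative bound with a
  vanishing amplitude**: if `P'(x) ≥ r(x - c)` on `[c, β]` (e.g. `P'(c) ≥ 0`, `P'' ≥ r`), `|P''| ≤ B`,
  `k(c) = 0`, `|k'| ≤ K₁`, then `‖∫_c^β k e^{iP}‖ ≤ (K₁/r)(3 + (1 + B/r) log(1 + (β - c)√r))`
  (trivially on `[c, c + r^{-1/2}]`, by parts beyond) — this is both the "defect" part of the weighted
  stationary phase (`k = g - g(c)`) and the estimate for a frequency whose stationary point lies at or
  beyond an end-point (`k = g`);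
* `weightedStationaryPhase_sharp` (+ `_neg`) — **stationary phase with amplitude**: under the hypotheses of
  `stationaryPhase_log` (`r ≤ P'' ≤ Ar`, `|P'''| ≤ λ₃`, `P'(c) = 0`, `α < c < β`) and `g(α) = g(β) = 0`,
  `|g'| ≤ G₁`:
  `‖∫_α^β g e^{iP} - g(c) 𝔣 e^{iP(c)} P''(c)^{-1/2}‖ ≤ |g(c)| 2A³(λ₃/r²)(2 + L₁ + L₂) + (G₁/r)(10 + 2A(L₁ + L₂))`,
  `L₁ = log(1 + (c-α)√r)`, `L₂ = log(1 + (β-c)√r)` (write `g = g(c) + (g - g(c))`; the end-point terms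
  `2/(r(c-α))` of the sharp lemma are multiplied by `|g(c)| ≤ G₁ (c - α)`);
* `norm_integral_amp_le_of_deriv_ge` — **the tail estimate** (two integrations by parts): if `|P'| ≥ D > 0`,
  `|P''| ≤ B₂`, `|P'''| ≤ B₃` and `g(α) = g(β) = 0`, `|g| ≤ G`, `|g'| ≤ G₁`, `|g''| ≤ G₂`, then
  `‖∫_α^β g e^{iP}‖ ≤ 2(G₁/D² + G B₂/D³) + (β - α)(G₂/D² + 3G₁B₂/D³ + G B₃/D³ + 3G B₂²/D⁴)`.

## References

* E. C. Titchmarsh, *The Theory of the Riemann Zeta-Function*, 2nd ed. (1986), §§4.3–4.6 (Lemmas 4.2–4.6).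
  [Titchmarsh1986]
* S. W. Graham, G. Kolesnik, *Van der Corput's Method of Exponential Sums*, LMS LN 126 (1991), §3 (Lemmas 3.1–3.4).
  [GrahamKolesnik1991]
* M. N. Huxley, *Area, Lattice Points, and Exponential Sums*, OUP 1996, §5.1 (the weighted first-derivative and
  stationary-phase lemmas). [Huxley1996]
-/

noncomputable section

open MeasureTheory Set intervalIntegral Complex Filter Topology

namespace Literature.Analysis.Fourier

/-! ### Two elementary lemmas -/

/-- `∫_{x₁}^{β} dx/(x - c) = log((β - c)/(x₁ - c))` for `c < x₁ ≤ β`. [folklore] -/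
theorem integral_inv_sub_eq_log {c x₁ β : ℝ} (h1 : c < x₁) (h2 : x₁ ≤ β) :
    ∫ x in x₁..β, (x - c)⁻¹ = Real.log ((β - c) / (x₁ - c)) := by
  rw [intervalIntegral.integral_comp_sub_right (fun x => x⁻¹) c, integral_inv_of_pos (by linarith) (by linarith)]

/-- With `η = min(r^{-1/2}, d)` (`r, d > 0`): `0 ≤ log(d/η) ≤ log(1 + d√r)` and `η² ≤ 1/r`. [folklore] -/
theorem log_div_min_le {r d : ℝ} (hr : 0 < r) (hd : 0 < d) :
    0 ≤ Real.log (d / min (1 / Real.sqrt r) d) ∧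
      Real.log (d / min (1 / Real.sqrt r) d) ≤ Real.log (1 + d * Real.sqrt r) ∧
        (min (1 / Real.sqrt r) d) ^ 2 ≤ 1 / r := by
  have hsr : 0 < Real.sqrt r := Real.sqrt_pos.2 hr
  have hη0 : 0 < min (1 / Real.sqrt r) d := lt_min (by positivity) hd
  refine ⟨Real.log_nonneg ?_, Real.log_le_log (div_pos hd hη0) ?_, ?_⟩
  · rw [le_div_iff₀ hη0, one_mul]; exact min_le_right _ _
  · rw [div_le_iff₀ hη0]
    rcases le_total (1 / Real.sqrt r) d with h | h
    · rw [min_eq_left h]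
      have : (1 + d * Real.sqrt r) * (1 / Real.sqrt r) = 1 / Real.sqrt r + d := by field_simp
      rw [this]
      have : 0 < 1 / Real.sqrt r := by positivity
      linarith
    · rw [min_eq_right h]
      nlinarith [mul_pos (mul_pos hd hsr) hd]
  · calc (min (1 / Real.sqrt r) d) ^ 2 ≤ (1 / Real.sqrt r) ^ 2 :=
          pow_le_pow_left₀ hη0.le (min_le_left _ _) 2
      _ = 1 / r := by rw [div_pow, one_pow, Real.sq_sqrt hr.le]

/-! ### Integration by parts against `e^{iP}` -/

/-- **The integration-by-parts identity.**  If `h, P, P'` are differentiable on `[α, β]` (`α ≤ β`), `h'` and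
`P''` are continuous there and `P' ≠ 0` on `[α, β]`, then
`∫_α^β h e^{iP} = -i (h(β)e^{iP(β)}/P'(β) - h(α)e^{iP(α)}/P'(α)) + i ∫_α^β (h'/P' - hP''/P'²) e^{iP}`.
[cite: Titchmarsh1986, Lemma 4.3 (proof)] -/
theorem integral_amp_mul_exp_eq_parts {h h' P P' P'' : ℝ → ℝ} {α β : ℝ} (hαβ : α ≤ β)
    (hh : ∀ x ∈ Icc α β, HasDerivAt h (h' x) x) (hh'c : ContinuousOn h' (Icc α β))
    (hP : ∀ x ∈ Icc α β, HasDerivAt P (P' x) x) (hP' : ∀ x ∈ Icc α β, HasDerivAt P' (P'' x) x)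
    (hP''c : ContinuousOn P'' (Icc α β)) (h0 : ∀ x ∈ Icc α β, P' x ≠ 0) :
    ∫ x in α..β, (h x : ℂ) * Complex.exp (I * P x)
      = -I * ((h β / P' β : ℝ) * Complex.exp (I * P β) - (h α / P' α : ℝ) * Complex.exp (I * P α))
        + I * ∫ x in α..β, ((h' x / P' x - h x * P'' x / (P' x) ^ 2 : ℝ) : ℂ) * Complex.exp (I * P x) := by
  have huI : uIcc α β = Icc α β := uIcc_of_le hαβ
  set E : ℝ → ℂ := fun x => Complex.exp (I * P x) with hE
  have hEc : ContinuousOn E (Icc α β) := continuousOn_exp_I_mul hP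
  have hhc : ContinuousOn h (Icc α β) := fun x hx => (hh x hx).continuousAt.continuousWithinAt
  have hPc' : ContinuousOn P' (Icc α β) := fun x hx => (hP' x hx).continuousAt.continuousWithinAt
  -- `u = -I h/P'`, `v = E`
  have hu : ∀ x ∈ uIcc α β, HasDerivAt (fun x => -I * ((h x / P' x : ℝ) : ℂ))
      (-I * ((h' x / P' x - h x * P'' x / (P' x) ^ 2 : ℝ) : ℂ)) x := by
    intro x hx; rw [huI] at hx
    have hd := ((hh x hx).div (hP' x hx) (h0 x hx)).ofReal_comp.const_mul (-I)
    refine hd.congr_deriv ?_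
    congr 1
    have hPx := h0 x hx
    have hAB : h' x / P' x - h x * P'' x / (P' x) ^ 2 = (h' x * P' x - h x * P'' x) / (P' x) ^ 2 := by
      field_simp
    rw [hAB]
  have hv : ∀ x ∈ uIcc α β, HasDerivAt E (I * P' x * E x) x := by
    intro x hx; rw [huI] at hx
    exact hasDerivAt_exp_I_mul (hP x hx)
  have hu' : IntervalIntegrable (fun x => -I * ((h' x / P' x - h x * P'' x / (P' x) ^ 2 : ℝ) : ℂ)) volume α β := by
    refine ContinuousOn.intervalIntegrable ?_
    rw [huI]
    refine continuousOn_const.mul (Complex.continuous_ofReal.comp_continuousOn ?_)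
    exact (hh'c.div hPc' h0).sub ((hhc.mul hP''c).div (hPc'.pow 2) fun x hx => pow_ne_zero 2 (h0 x hx))
  have hv' : IntervalIntegrable (fun x => I * P' x * E x) volume α β := by
    refine ContinuousOn.intervalIntegrable ?_
    rw [huI]
    exact (continuousOn_const.mul (Complex.continuous_ofReal.comp_continuousOn hPc')).mul hEc
  have hparts := intervalIntegral.integral_mul_deriv_eq_deriv_mul hu hv hu' hv'
  have hlhs : (∫ x in α..β, (h x : ℂ) * E x) = ∫ x in α..β, (-I * ((h x / P' x : ℝ) : ℂ)) * (I * P' x * E x) := by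
    refine intervalIntegral.integral_congr fun x hx => ?_
    rw [huI] at hx
    have : (P' x : ℂ) ≠ 0 := by exact_mod_cast h0 x hx
    push_cast
    have hre : -I * ((h x : ℂ) / P' x) * (I * P' x * E x) = -(I * I) * ((h x : ℂ) * E x) * (P' x / P' x) := by ring
    rw [hre, Complex.I_mul_I, div_self this]
    ring
  have hI : (∫ x in α..β, -I * ((h' x / P' x - h x * P'' x / (P' x) ^ 2 : ℝ) : ℂ) * E x)
      = -I * ∫ x in α..β, ((h' x / P' x - h x * P'' x / (P' x) ^ 2 : ℝ) : ℂ) * E x := by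
    rw [← intervalIntegral.integral_const_mul]
    refine intervalIntegral.integral_congr fun x _ => ?_
    ring
  rw [hlhs, hparts, hI]
  simp only [hE]
  push_cast
  ring

/-! ### One-sided first-derivative bound with a vanishing amplitude -/

/-- **First-derivative bound with an amplitude vanishing at the critical end-point** (right side).
Let `c ≤ β`, `r > 0`; `P, P'` differentiable on `[c, β]` with `P''` continuous, `P'(x) ≥ r(x - c)` and
`|P''(x)| ≤ B` there; `k` differentiable with `k'` continuous, `|k'| ≤ K₁`, `k(c) = 0`.  Then
`‖∫_c^β k(x) e^{iP(x)} dx‖ ≤ (K₁/r)(3 + (1 + B/r) log(1 + (β - c)√r))`.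
Proof: `|k(x)| ≤ K₁(x - c)`; the piece `[c, c + η]`, `η = min(r^{-1/2}, β - c)`, is `≤ K₁η² ≤ K₁/r`; on
`[c + η, β]` integrate by parts: `|k/P'| ≤ K₁/r`, `|(k/P')'| ≤ (K₁/r)(1 + B/r)/(x - c)`.
[cite: GrahamKolesnik1991, Lemma 3.1] [cite: Titchmarsh1986, Lemma 4.3] -/
theorem norm_integral_amp_right_le {P P' P'' k k' : ℝ → ℝ} {c β r B K₁ : ℝ} (hcβ : c ≤ β) (hr : 0 < r)
    (hB : 0 ≤ B) (hK : 0 ≤ K₁)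
    (hP : ∀ x ∈ Icc c β, HasDerivAt P (P' x) x) (hP' : ∀ x ∈ Icc c β, HasDerivAt P' (P'' x) x)
    (hP''c : ContinuousOn P'' (Icc c β))
    (hlow : ∀ x ∈ Icc c β, r * (x - c) ≤ P' x) (hB2 : ∀ x ∈ Icc c β, |P'' x| ≤ B)
    (hk : ∀ x ∈ Icc c β, HasDerivAt k (k' x) x) (hk'c : ContinuousOn k' (Icc c β))
    (hK1 : ∀ x ∈ Icc c β, |k' x| ≤ K₁) (hk0 : k c = 0) :
    ‖∫ x in c..β, (k x : ℂ) * Complex.exp (I * P x)‖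
      ≤ K₁ / r * (3 + (1 + B / r) * Real.log (1 + (β - c) * Real.sqrt r)) := by
  have hsr : 0 < Real.sqrt r := Real.sqrt_pos.2 hr
  rcases eq_or_lt_of_le hcβ with h | hcβ'
  · subst h
    rw [intervalIntegral.integral_same, norm_zero, sub_self, zero_mul, add_zero, Real.log_one, mul_zero, add_zero]
    positivity
  -- notation and basic facts
  set E : ℝ → ℂ := fun x => Complex.exp (I * P x) with hE
  have hEc : ContinuousOn E (Icc c β) := continuousOn_exp_I_mul hP
  have hEn : ∀ x, ‖E x‖ = 1 := fun x => norm_exp_I_mul_ofReal (P x)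
  have hkc : ContinuousOn k (Icc c β) := fun x hx => (hk x hx).continuousAt.continuousWithinAt
  have hkb : ∀ x ∈ Icc c β, |k x| ≤ K₁ * (x - c) := by
    intro x hx
    rcases eq_or_lt_of_le hx.1 with h | h
    · subst h; simp [hk0]
    have hsub : Icc c x ⊆ Icc c β := Icc_subset_Icc le_rfl hx.2
    obtain ⟨ξ, hξ, hξ'⟩ := exists_hasDerivAt_eq_sub h (fun y hy => hk y (hsub hy))
    rw [hk0, sub_zero] at hξ'
    rw [hξ', abs_mul, abs_of_pos (sub_pos.2 h)]
    exact mul_le_mul_of_nonneg_right (hK1 ξ (hsub (Ioo_subset_Icc_self hξ))) (by linarith)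
  have hi : ∀ p ∈ Icc c β, ∀ q ∈ Icc c β, IntervalIntegrable (fun x => (k x : ℂ) * E x) volume p q :=
    fun p hp q hq => (((Complex.continuous_ofReal.comp_continuousOn hkc).mul hEc).mono
      (uIcc_subset_Icc hp hq)).intervalIntegrable
  -- the split point
  set η₁ : ℝ := min (1 / Real.sqrt r) (β - c) with hη₁
  obtain ⟨hlog0, hlog, hη₁sq⟩ := log_div_min_le hr (sub_pos.2 hcβ')
  have hη₁0 : 0 < η₁ := lt_min (by positivity) (sub_pos.2 hcβ')
  have hη₁2 : η₁ ≤ β - c := min_le_right _ _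
  set x₁ : ℝ := c + η₁ with hx₁
  have hcx₁ : c < x₁ := by rw [hx₁]; linarith
  have hx₁β : x₁ ≤ β := by rw [hx₁]; linarith
  have hx₁I : x₁ ∈ Icc c β := ⟨hcx₁.le, hx₁β⟩
  have hcI : c ∈ Icc c β := left_mem_Icc.2 hcβ
  have hβI : β ∈ Icc c β := right_mem_Icc.2 hcβ
  -- ### the short piece
  have hC1 : ‖∫ x in c..x₁, (k x : ℂ) * E x‖ ≤ K₁ / r := by
    have hb : ∀ x ∈ Set.uIoc c x₁, ‖(k x : ℂ) * E x‖ ≤ K₁ * η₁ := by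
      intro x hx
      rw [uIoc_of_le hcx₁.le] at hx
      rw [norm_mul, hEn, mul_one, Complex.norm_real, Real.norm_eq_abs]
      refine (hkb x ⟨hx.1.le, hx.2.trans hx₁β⟩).trans ?_
      exact mul_le_mul_of_nonneg_left (by rw [hx₁] at hx; linarith [hx.2]) hK
    refine (intervalIntegral.norm_integral_le_of_norm_le_const hb).trans ?_
    rw [show x₁ - c = η₁ by rw [hx₁]; ring, abs_of_pos hη₁0]
    calc K₁ * η₁ * η₁ = K₁ * η₁ ^ 2 := by ring
      _ ≤ K₁ * (1 / r) := by gcongr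
      _ = K₁ / r := by ring
  -- ### the long piece, by parts
  have hC2 : ‖∫ x in x₁..β, (k x : ℂ) * E x‖ ≤ 2 * (K₁ / r) + K₁ / r * (1 + B / r) * Real.log ((β - c) / η₁) := by
    have hsub' : Icc x₁ β ⊆ Icc c β := fun x hx => ⟨hcx₁.le.trans hx.1, hx.2⟩
    have hP0 : ∀ x ∈ Icc x₁ β, r * (x - c) ≤ P' x := fun x hx => hlow x (hsub' hx)
    have hP0' : ∀ x ∈ Icc x₁ β, P' x ≠ 0 := fun x hx =>
      (lt_of_lt_of_le (mul_pos hr (by linarith [hx.1])) (hP0 x hx)).ne'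
    rw [integral_amp_mul_exp_eq_parts hx₁β (fun x hx => hk x (hsub' hx)) (hk'c.mono hsub')
      (fun x hx => hP x (hsub' hx)) (fun x hx => hP' x (hsub' hx)) (hP''c.mono hsub') hP0']
    -- boundary terms
    have hbd : ∀ x ∈ Icc x₁ β, ‖((k x / P' x : ℝ) : ℂ) * E x‖ ≤ K₁ / r := by
      intro x hx
      have hxc : 0 < x - c := by linarith [hx.1]
      have hPx : 0 < P' x := lt_of_lt_of_le (mul_pos hr hxc) (hP0 x hx)
      rw [norm_mul, hEn, mul_one, Complex.norm_real, Real.norm_eq_abs, abs_div, abs_of_pos hPx]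
      calc |k x| / P' x ≤ K₁ * (x - c) / (r * (x - c)) :=
            div_le_div₀ (by positivity) (hkb x (hsub' hx)) (by positivity) (hP0 x hx)
        _ = K₁ / r := by field_simp
    -- the integrand after parts
    have hint : ‖∫ x in x₁..β, ((k' x / P' x - k x * P'' x / (P' x) ^ 2 : ℝ) : ℂ) * E x‖
        ≤ K₁ / r * (1 + B / r) * Real.log ((β - c) / η₁) := by
      have hb : ∀ᵐ x : ℝ, x ∈ Ioc x₁ β →
          ‖((k' x / P' x - k x * P'' x / (P' x) ^ 2 : ℝ) : ℂ) * E x‖ ≤ K₁ / r * (1 + B / r) * (x - c)⁻¹ := by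
        refine Eventually.of_forall fun x hx => ?_
        have hxI : x ∈ Icc x₁ β := ⟨hx.1.le, hx.2⟩
        have hxc : 0 < x - c := by linarith [hx.1]
        have hPx : 0 < P' x := lt_of_lt_of_le (mul_pos hr hxc) (hP0 x hxI)
        have hPl := hP0 x hxI
        rw [norm_mul, hEn, mul_one, Complex.norm_real, Real.norm_eq_abs]
        have h1 : |k' x / P' x| ≤ K₁ / (r * (x - c)) := by
          rw [abs_div, abs_of_pos hPx]
          exact div_le_div₀ hK (hK1 x (hsub' hxI)) (by positivity) hPl
        have h2 : |k x * P'' x / (P' x) ^ 2| ≤ K₁ * B / (r ^ 2 * (x - c)) := by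
          rw [abs_div, abs_mul, abs_of_pos (by positivity : (0 : ℝ) < (P' x) ^ 2)]
          have hsq : (r * (x - c)) ^ 2 ≤ (P' x) ^ 2 := pow_le_pow_left₀ (by positivity) hPl 2
          calc |k x| * |P'' x| / (P' x) ^ 2 ≤ K₁ * (x - c) * B / (r * (x - c)) ^ 2 :=
                div_le_div₀ (by positivity) (mul_le_mul (hkb x (hsub' hxI)) (hB2 x (hsub' hxI)) (abs_nonneg _)
                  (by positivity)) (by positivity) hsq
            _ = K₁ * B / (r ^ 2 * (x - c)) := by field_simp
        calc |k' x / P' x - k x * P'' x / (P' x) ^ 2|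
            ≤ |k' x / P' x| + |k x * P'' x / (P' x) ^ 2| := abs_sub _ _
          _ ≤ K₁ / (r * (x - c)) + K₁ * B / (r ^ 2 * (x - c)) := add_le_add h1 h2
          _ = K₁ / r * (1 + B / r) * (x - c)⁻¹ := by field_simp
      have hgi : IntervalIntegrable (fun x => K₁ / r * (1 + B / r) * (x - c)⁻¹) volume x₁ β := by
        refine ContinuousOn.intervalIntegrable ?_
        rw [uIcc_of_le hx₁β]
        refine continuousOn_const.mul (ContinuousOn.inv₀ (continuousOn_id.sub continuousOn_const) ?_)
        intro x hx; exact (sub_pos.2 (hcx₁.trans_le hx.1)).ne'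
      refine (intervalIntegral.norm_integral_le_of_norm_le hx₁β hb hgi).trans (le_of_eq ?_)
      rw [intervalIntegral.integral_const_mul, integral_inv_sub_eq_log hcx₁ hx₁β, show x₁ - c = η₁ by rw [hx₁]; ring]
    calc ‖-I * (((k β / P' β : ℝ) : ℂ) * E β - ((k x₁ / P' x₁ : ℝ) : ℂ) * E x₁)
          + I * ∫ x in x₁..β, ((k' x / P' x - k x * P'' x / (P' x) ^ 2 : ℝ) : ℂ) * E x‖
        ≤ ‖((k β / P' β : ℝ) : ℂ) * E β - ((k x₁ / P' x₁ : ℝ) : ℂ) * E x₁‖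
          + ‖∫ x in x₁..β, ((k' x / P' x - k x * P'' x / (P' x) ^ 2 : ℝ) : ℂ) * E x‖ := by
          refine (norm_add_le _ _).trans (le_of_eq ?_)
          rw [norm_mul, norm_mul, norm_neg, Complex.norm_I, one_mul, one_mul]
      _ ≤ (K₁ / r + K₁ / r) + K₁ / r * (1 + B / r) * Real.log ((β - c) / η₁) :=
          add_le_add ((norm_sub_le _ _).trans (add_le_add (hbd β ⟨hx₁β, le_rfl⟩) (hbd x₁ ⟨le_rfl, hx₁β⟩))) hint
      _ = 2 * (K₁ / r) + K₁ / r * (1 + B / r) * Real.log ((β - c) / η₁) := by ring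
  -- ### assembly
  rw [← intervalIntegral.integral_add_adjacent_intervals (hi c hcI x₁ hx₁I) (hi x₁ hx₁I β hβI)]
  refine (norm_add_le _ _).trans ?_
  have h0 : 0 ≤ K₁ / r * (1 + B / r) := by positivity
  have := mul_le_mul_of_nonneg_left hlog h0
  nlinarith [hC1, hC2]

/-- **First-derivative bound with an amplitude vanishing at the critical end-point** (left side): if
`-P'(x) ≥ r(c - x)` on `[α, c]` (e.g. `P'(c) ≤ 0`, `P'' ≥ r`), `|P''| ≤ B`, `k(c) = 0`, `|k'| ≤ K₁`, then
`‖∫_α^c k e^{iP}‖ ≤ (K₁/r)(3 + (1 + B/r) log(1 + (c - α)√r))` (reflect `x ↦ 2c - x`).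
[cite: GrahamKolesnik1991, Lemma 3.1] [cite: Titchmarsh1986, Lemma 4.3] -/
theorem norm_integral_amp_left_le {P P' P'' k k' : ℝ → ℝ} {α c r B K₁ : ℝ} (hαc : α ≤ c) (hr : 0 < r)
    (hB : 0 ≤ B) (hK : 0 ≤ K₁)
    (hP : ∀ x ∈ Icc α c, HasDerivAt P (P' x) x) (hP' : ∀ x ∈ Icc α c, HasDerivAt P' (P'' x) x)
    (hP''c : ContinuousOn P'' (Icc α c))
    (hlow : ∀ x ∈ Icc α c, r * (c - x) ≤ -P' x) (hB2 : ∀ x ∈ Icc α c, |P'' x| ≤ B)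
    (hk : ∀ x ∈ Icc α c, HasDerivAt k (k' x) x) (hk'c : ContinuousOn k' (Icc α c))
    (hK1 : ∀ x ∈ Icc α c, |k' x| ≤ K₁) (hk0 : k c = 0) :
    ‖∫ x in α..c, (k x : ℂ) * Complex.exp (I * P x)‖
      ≤ K₁ / r * (3 + (1 + B / r) * Real.log (1 + (c - α) * Real.sqrt r)) := by
  have hrefl : ∀ y ∈ Icc c (2 * c - α), 2 * c - y ∈ Icc α c :=
    fun y hy => ⟨by linarith [hy.2], by linarith [hy.1]⟩
  have hd : ∀ y : ℝ, HasDerivAt (fun y : ℝ => 2 * c - y) (-1) y := fun y => by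
    simpa using (hasDerivAt_id y).const_sub (2 * c)
  have hQ : ∀ y ∈ Icc c (2 * c - α), HasDerivAt (fun y => P (2 * c - y)) (-P' (2 * c - y)) y := by
    intro y hy
    exact ((hP (2 * c - y) (hrefl y hy)).comp y (hd y)).congr_deriv (by ring)
  have hQ' : ∀ y ∈ Icc c (2 * c - α), HasDerivAt (fun y => -P' (2 * c - y)) (P'' (2 * c - y)) y := by
    intro y hy
    exact ((hP' (2 * c - y) (hrefl y hy)).comp y (hd y)).neg.congr_deriv (by ring)
  have hK' : ∀ y ∈ Icc c (2 * c - α), HasDerivAt (fun y => k (2 * c - y)) (-k' (2 * c - y)) y := by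
    intro y hy
    exact ((hk (2 * c - y) (hrefl y hy)).comp y (hd y)).congr_deriv (by ring)
  have hcont : Continuous fun y : ℝ => 2 * c - y := by fun_prop
  have hmaps : MapsTo (fun y : ℝ => 2 * c - y) (Icc c (2 * c - α)) (Icc α c) := hrefl
  have key := norm_integral_amp_right_le (P := fun y => P (2 * c - y)) (P' := fun y => -P' (2 * c - y))
    (P'' := fun y => P'' (2 * c - y)) (k := fun y => k (2 * c - y)) (k' := fun y => -k' (2 * c - y))
    (c := c) (β := 2 * c - α) (r := r) (B := B) (K₁ := K₁) (by linarith) hr hB hK hQ hQ'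
    (hP''c.comp hcont.continuousOn hmaps) (fun y hy => by have := hlow _ (hrefl y hy); linarith)
    (fun y hy => hB2 _ (hrefl y hy)) hK' ((hk'c.comp hcont.continuousOn hmaps).neg)
    (fun y hy => by rw [abs_neg]; exact hK1 _ (hrefl y hy))
    (by show k (2 * c - c) = 0; rw [show (2 : ℝ) * c - c = c by ring]; exact hk0)
  have hsub : (∫ y in c..(2 * c - α), ((k (2 * c - y) : ℝ) : ℂ) * Complex.exp (I * ((P (2 * c - y) : ℝ) : ℂ)))
      = ∫ x in α..c, (k x : ℂ) * Complex.exp (I * P x) := by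
    rw [intervalIntegral.integral_comp_sub_left (fun x => (k x : ℂ) * Complex.exp (I * P x)) (2 * c)]
    congr 1 <;> ring
  rw [hsub, show 2 * c - α - c = c - α by ring] at key
  exact key

/-! ### Stationary phase with an amplitude -/

/-- **Weighted sharp stationary phase** (convex case).  Under the hypotheses of `stationaryPhase_log`
(`r ≤ P'' ≤ Ar`, `|P'''| ≤ λ₃` on `[α, β]`, `P'(c) = 0`, `α < c < β`) and for an amplitude `g` with two
derivatives on `[α, β]`, `|g'| ≤ G₁`, `g(α) = g(β) = 0`:
`‖∫_α^β g(x)e^{iP(x)} dx - g(c) 𝔣 e^{iP(c)} P''(c)^{-1/2}‖`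
`  ≤ |g(c)| · 2A³(λ₃/r²)(2 + L₁ + L₂) + (G₁/r)(10 + 2A(L₁ + L₂))`,
`L₁ = log(1 + (c - α)√r)`, `L₂ = log(1 + (β - c)√r)`.
[cite: GrahamKolesnik1991, Lemma 3.4] [cite: Titchmarsh1986, Lemma 4.6] -/
theorem weightedStationaryPhase_sharp {P P' P'' P''' g g' g'' : ℝ → ℝ} {α β c r A lam3 G₁ : ℝ}
    (hαc : α < c) (hcβ : c < β) (hr : 0 < r) (hA : 1 ≤ A)
    (hP : ∀ x ∈ Icc α β, HasDerivAt P (P' x) x) (hP' : ∀ x ∈ Icc α β, HasDerivAt P' (P'' x) x)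
    (hP'' : ∀ x ∈ Icc α β, HasDerivAt P'' (P''' x) x)
    (h2 : ∀ x ∈ Icc α β, r ≤ P'' x ∧ P'' x ≤ A * r) (h3 : ∀ x ∈ Icc α β, |P''' x| ≤ lam3) (hc : P' c = 0)
    (hg : ∀ x ∈ Icc α β, HasDerivAt g (g' x) x) (hg' : ∀ x ∈ Icc α β, HasDerivAt g' (g'' x) x)
    (hG1 : ∀ x ∈ Icc α β, |g' x| ≤ G₁) (hgα : g α = 0) (hgβ : g β = 0) :
    ‖(∫ x in α..β, (g x : ℂ) * Complex.exp (I * P x))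
        - (g c : ℂ) * (fresnelC * Complex.exp (I * P c) * ((Real.sqrt (P'' c))⁻¹ : ℝ))‖
      ≤ |g c| * (2 * A ^ 3 * (lam3 / r ^ 2) *
            (2 + Real.log (1 + (c - α) * Real.sqrt r) + Real.log (1 + (β - c) * Real.sqrt r)))
        + G₁ / r * (10 + 2 * A * (Real.log (1 + (c - α) * Real.sqrt r) + Real.log (1 + (β - c) * Real.sqrt r))) := by
  have hαβ : α ≤ β := (hαc.trans hcβ).le
  have hcI : c ∈ Icc α β := ⟨hαc.le, hcβ.le⟩
  have hA0 : 0 < A := by linarith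
  have hG : 0 ≤ G₁ := (abs_nonneg _).trans (hG1 c hcI)
  have hl : 0 ≤ lam3 := (abs_nonneg _).trans (h3 c hcI)
  set L₁ := Real.log (1 + (c - α) * Real.sqrt r) with hL₁
  set L₂ := Real.log (1 + (β - c) * Real.sqrt r) with hL₂
  have hsr : 0 < Real.sqrt r := Real.sqrt_pos.2 hr
  have hL₁0 : 0 ≤ L₁ := Real.log_nonneg (by nlinarith [hsr, hαc])
  have hL₂0 : 0 ≤ L₂ := Real.log_nonneg (by nlinarith [hsr, hcβ])
  set E : ℝ → ℂ := fun x => Complex.exp (I * P x) with hE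
  have hEc : ContinuousOn E (Icc α β) := continuousOn_exp_I_mul hP
  have hgc : ContinuousOn g (Icc α β) := fun x hx => (hg x hx).continuousAt.continuousWithinAt
  have hg'c : ContinuousOn g' (Icc α β) := fun x hx => (hg' x hx).continuousAt.continuousWithinAt
  have hP''c : ContinuousOn P'' (Icc α β) := fun x hx => (hP'' x hx).continuousAt.continuousWithinAt
  -- `|g(c)| ≤ G₁ (c - α)`, `|g(c)| ≤ G₁ (β - c)`
  have hgc1 : |g c| ≤ G₁ * (c - α) := by
    obtain ⟨ξ, hξ, hξ'⟩ := exists_hasDerivAt_eq_sub hαc (fun y hy => hg y ⟨hy.1, hy.2.trans hcβ.le⟩)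
    rw [hgα, sub_zero] at hξ'
    rw [hξ', abs_mul, abs_of_pos (sub_pos.2 hαc)]
    exact mul_le_mul_of_nonneg_right (hG1 ξ ⟨hξ.1.le, hξ.2.le.trans hcβ.le⟩) (by linarith)
  have hgc2 : |g c| ≤ G₁ * (β - c) := by
    obtain ⟨ξ, hξ, hξ'⟩ := exists_hasDerivAt_eq_sub hcβ (fun y hy => hg y ⟨hαc.le.trans hy.1, hy.2⟩)
    rw [hgβ, zero_sub] at hξ'
    have : |g c| = |g' ξ| * (β - c) := by
      rw [← abs_neg, hξ', abs_mul, abs_of_pos (sub_pos.2 hcβ)]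
    rw [this]
    exact mul_le_mul_of_nonneg_right (hG1 ξ ⟨hαc.le.trans hξ.1.le, hξ.2.le⟩) (by linarith)
  -- ### the main part `g(c) ∫ e^{iP}`
  have hmain := stationaryPhase_log hαc hcβ hr hA hP hP' hP'' h2 h3 hc
  have hmain' : ‖(g c : ℂ) * ((∫ x in α..β, E x) - fresnelC * Complex.exp (I * P c) * ((Real.sqrt (P'' c))⁻¹ : ℝ))‖
      ≤ 4 * (G₁ / r) + |g c| * (2 * A ^ 3 * (lam3 / r ^ 2) * (2 + L₁ + L₂)) := by
    rw [norm_mul, Complex.norm_real, Real.norm_eq_abs]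
    refine (mul_le_mul_of_nonneg_left hmain (abs_nonneg _)).trans ?_
    have hca : c - α ≠ 0 := (sub_pos.2 hαc).ne'
    have hbc : β - c ≠ 0 := (sub_pos.2 hcβ).ne'
    have h1 : |g c| * (2 / (r * (c - α))) ≤ 2 * (G₁ / r) := by
      calc |g c| * (2 / (r * (c - α))) ≤ G₁ * (c - α) * (2 / (r * (c - α))) :=
            mul_le_mul_of_nonneg_right hgc1 (by positivity)
        _ = 2 * (G₁ / r) := by field_simp
    have h2' : |g c| * (2 / (r * (β - c))) ≤ 2 * (G₁ / r) := by
      calc |g c| * (2 / (r * (β - c))) ≤ G₁ * (β - c) * (2 / (r * (β - c))) :=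
            mul_le_mul_of_nonneg_right hgc2 (by positivity)
        _ = 2 * (G₁ / r) := by field_simp
    nlinarith [h1, h2', abs_nonneg (g c)]
  -- ### the defect part `∫ (g - g(c)) e^{iP}`, two sides
  have hsubR : Icc c β ⊆ Icc α β := Icc_subset_Icc hαc.le le_rfl
  have hsubL : Icc α c ⊆ Icc α β := Icc_subset_Icc le_rfl hcβ.le
  have hk : ∀ x ∈ Icc α β, HasDerivAt (fun x => g x - g c) (g' x) x := fun x hx => (hg x hx).sub_const _
  have hB2 : ∀ x ∈ Icc α β, |P'' x| ≤ A * r := fun x hx => by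
    rw [abs_of_pos (hr.trans_le (h2 x hx).1)]; exact (h2 x hx).2
  have hright : ‖∫ x in c..β, ((g x - g c : ℝ) : ℂ) * E x‖ ≤ G₁ / r * (3 + (1 + A * r / r) * L₂) :=
    norm_integral_amp_right_le (k := fun x => g x - g c) hcβ.le hr (by positivity) hG
      (fun x hx => hP x (hsubR hx)) (fun x hx => hP' x (hsubR hx)) (hP''c.mono hsubR)
      (fun x hx => (deriv_bounds_right hP' (fun y hy => ⟨(h2 y hy).1, (h2 y hy).2⟩) hcI hc (hsubR hx) hx.1).1)
      (fun x hx => hB2 x (hsubR hx)) (fun x hx => hk x (hsubR hx)) (hg'c.mono hsubR)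
      (fun x hx => hG1 x (hsubR hx)) (by simp)
  have hleft : ‖∫ x in α..c, ((g x - g c : ℝ) : ℂ) * E x‖ ≤ G₁ / r * (3 + (1 + A * r / r) * L₁) :=
    norm_integral_amp_left_le (k := fun x => g x - g c) hαc.le hr (by positivity) hG
      (fun x hx => hP x (hsubL hx)) (fun x hx => hP' x (hsubL hx)) (hP''c.mono hsubL)
      (fun x hx => (deriv_bounds_left hP' (fun y hy => ⟨(h2 y hy).1, (h2 y hy).2⟩) hcI hc (hsubL hx) hx.2).1)
      (fun x hx => hB2 x (hsubL hx)) (fun x hx => hk x (hsubL hx)) (hg'c.mono hsubL)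
      (fun x hx => hG1 x (hsubL hx)) (by simp)
  rw [mul_div_assoc, div_self hr.ne', mul_one] at hright hleft
  -- ### assembly
  have hi : ∀ p ∈ Icc α β, ∀ q ∈ Icc α β, IntervalIntegrable (fun x => ((g x - g c : ℝ) : ℂ) * E x) volume p q :=
    fun p hp q hq => (((Complex.continuous_ofReal.comp_continuousOn (hgc.sub continuousOn_const)).mul hEc).mono
      (uIcc_subset_Icc hp hq)).intervalIntegrable
  have hiE : IntervalIntegrable E volume α β := (hEc.mono (by rw [uIcc_of_le hαβ])).intervalIntegrable
  have hsplit : (∫ x in α..β, (g x : ℂ) * E x)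
      = (g c : ℂ) * (∫ x in α..β, E x) + ∫ x in α..β, ((g x - g c : ℝ) : ℂ) * E x := by
    rw [← intervalIntegral.integral_const_mul, ← intervalIntegral.integral_add (hiE.const_mul _)
      (hi α (left_mem_Icc.2 hαβ) β (right_mem_Icc.2 hαβ))]
    refine intervalIntegral.integral_congr fun x _ => ?_
    push_cast; ring
  have hdef : ‖∫ x in α..β, ((g x - g c : ℝ) : ℂ) * E x‖ ≤ G₁ / r * (6 + (1 + A) * (L₁ + L₂)) := by
    rw [← intervalIntegral.integral_add_adjacent_intervals (hi α (left_mem_Icc.2 hαβ) c hcI)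
      (hi c hcI β (right_mem_Icc.2 hαβ))]
    refine (norm_add_le _ _).trans ?_
    have : G₁ / r * (3 + (1 + A) * L₁) + G₁ / r * (3 + (1 + A) * L₂) = G₁ / r * (6 + (1 + A) * (L₁ + L₂)) := by ring
    linarith [hleft, hright]
  calc ‖(∫ x in α..β, (g x : ℂ) * E x) - (g c : ℂ) * (fresnelC * Complex.exp (I * P c) * ((Real.sqrt (P'' c))⁻¹ : ℝ))‖
      = ‖(g c : ℂ) * ((∫ x in α..β, E x) - fresnelC * Complex.exp (I * P c) * ((Real.sqrt (P'' c))⁻¹ : ℝ))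
          + ∫ x in α..β, ((g x - g c : ℝ) : ℂ) * E x‖ := by rw [hsplit]; congr 1; ring
    _ ≤ (4 * (G₁ / r) + |g c| * (2 * A ^ 3 * (lam3 / r ^ 2) * (2 + L₁ + L₂)))
        + G₁ / r * (6 + (1 + A) * (L₁ + L₂)) := (norm_add_le _ _).trans (add_le_add hmain' hdef)
    _ ≤ |g c| * (2 * A ^ 3 * (lam3 / r ^ 2) * (2 + L₁ + L₂)) + G₁ / r * (10 + 2 * A * (L₁ + L₂)) := by
        have h0 : 0 ≤ G₁ / r * (L₁ + L₂) := by positivity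
        nlinarith [h0]

/-- **Weighted sharp stationary phase, concave case** (`r ≤ -P'' ≤ Ar`; constant `conj 𝔣`, `|P''(c)|^{-1/2}`).
[cite: GrahamKolesnik1991, Lemma 3.4] [cite: Titchmarsh1986, Lemma 4.6] -/
theorem weightedStationaryPhase_sharp_neg {P P' P'' P''' g g' g'' : ℝ → ℝ} {α β c r A lam3 G₁ : ℝ}
    (hαc : α < c) (hcβ : c < β) (hr : 0 < r) (hA : 1 ≤ A)
    (hP : ∀ x ∈ Icc α β, HasDerivAt P (P' x) x) (hP' : ∀ x ∈ Icc α β, HasDerivAt P' (P'' x) x)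
    (hP'' : ∀ x ∈ Icc α β, HasDerivAt P'' (P''' x) x)
    (h2 : ∀ x ∈ Icc α β, r ≤ -P'' x ∧ -P'' x ≤ A * r) (h3 : ∀ x ∈ Icc α β, |P''' x| ≤ lam3) (hc : P' c = 0)
    (hg : ∀ x ∈ Icc α β, HasDerivAt g (g' x) x) (hg' : ∀ x ∈ Icc α β, HasDerivAt g' (g'' x) x)
    (hG1 : ∀ x ∈ Icc α β, |g' x| ≤ G₁) (hgα : g α = 0) (hgβ : g β = 0) :
    ‖(∫ x in α..β, (g x : ℂ) * Complex.exp (I * P x))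
        - (g c : ℂ) * ((starRingEnd ℂ) fresnelC * Complex.exp (I * P c) * ((Real.sqrt (-P'' c))⁻¹ : ℝ))‖
      ≤ |g c| * (2 * A ^ 3 * (lam3 / r ^ 2) *
            (2 + Real.log (1 + (c - α) * Real.sqrt r) + Real.log (1 + (β - c) * Real.sqrt r)))
        + G₁ / r * (10 + 2 * A * (Real.log (1 + (c - α) * Real.sqrt r) + Real.log (1 + (β - c) * Real.sqrt r))) := by
  have hab : α ≤ β := (hαc.trans hcβ).le
  have key := weightedStationaryPhase_sharp (P := fun x => -P x) (P' := fun x => -P' x) (P'' := fun x => -P'' x)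
    (P''' := fun x => -P''' x) (g := g) (g' := g') (g'' := g'') hαc hcβ hr hA (fun x hx => (hP x hx).neg)
    (fun x hx => (hP' x hx).neg) (fun x hx => (hP'' x hx).neg) h2
    (fun x hx => by rw [abs_neg]; exact h3 x hx) (by simp [hc]) hg hg' hG1 hgα hgβ
  have h1 : (starRingEnd ℂ) (∫ x in α..β, (g x : ℂ) * Complex.exp (I * ((-P x : ℝ) : ℂ)))
      = ∫ x in α..β, (g x : ℂ) * Complex.exp (I * P x) := by
    rw [intervalIntegral.integral_of_le hab, intervalIntegral.integral_of_le hab, ← integral_conj]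
    refine setIntegral_congr_fun measurableSet_Ioc fun x _ => ?_
    rw [map_mul, Complex.conj_ofReal, ← Complex.exp_conj, map_mul, Complex.conj_I, Complex.conj_ofReal]
    push_cast
    ring_nf
  have h2c : (starRingEnd ℂ) ((g c : ℂ) * (fresnelC * Complex.exp (I * ((-P c : ℝ) : ℂ))
        * (((Real.sqrt (-P'' c))⁻¹ : ℝ) : ℂ)))
      = (g c : ℂ) * ((starRingEnd ℂ) fresnelC * Complex.exp (I * P c) * ((Real.sqrt (-P'' c))⁻¹ : ℝ)) := by
    rw [map_mul, map_mul, map_mul, Complex.conj_ofReal, Complex.conj_ofReal, ← Complex.exp_conj, map_mul,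
      Complex.conj_I, Complex.conj_ofReal]
    push_cast
    ring_nf
  rw [← h1, ← h2c, ← map_sub, RCLike.norm_conj]
  exact key

/-! ### The tail estimate: two integrations by parts -/

/-- **The tail estimate** (no stationary point, `|P'| ≥ D`): if `P, P', P''` are differentiable on `[α, β]`
(`α ≤ β`) with `P'''` continuous, `|P'| ≥ D > 0`, `|P''| ≤ B₂`, `|P'''| ≤ B₃` there, and `g` has two
derivatives with `g''` continuous, `|g| ≤ G`, `|g'| ≤ G₁`, `|g''| ≤ G₂`, `g(α) = g(β) = 0`, then
`‖∫_α^β g e^{iP}‖ ≤ 2(G₁/D² + G B₂/D³) + (β - α)(G₂/D² + 3G₁B₂/D³ + G B₃/D³ + 3G B₂²/D⁴)`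
(integrate by parts twice; the first boundary terms vanish). [cite: Titchmarsh1986, Lemma 4.3]
[cite: GrahamKolesnik1991, Lemma 3.1] -/
theorem norm_integral_amp_le_of_deriv_ge {P P' P'' P''' g g' g'' : ℝ → ℝ} {α β D B₂ B₃ G G₁ G₂ : ℝ}
    (hαβ : α ≤ β) (hD : 0 < D) (hB₂ : 0 ≤ B₂) (hB₃ : 0 ≤ B₃) (hG : 0 ≤ G) (hG₁ : 0 ≤ G₁) (hG₂ : 0 ≤ G₂)
    (hP : ∀ x ∈ Icc α β, HasDerivAt P (P' x) x) (hP' : ∀ x ∈ Icc α β, HasDerivAt P' (P'' x) x)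
    (hP'' : ∀ x ∈ Icc α β, HasDerivAt P'' (P''' x) x) (hP'''c : ContinuousOn P''' (Icc α β))
    (hDb : ∀ x ∈ Icc α β, D ≤ |P' x|) (hB2 : ∀ x ∈ Icc α β, |P'' x| ≤ B₂) (hB3 : ∀ x ∈ Icc α β, |P''' x| ≤ B₃)
    (hg : ∀ x ∈ Icc α β, HasDerivAt g (g' x) x) (hg' : ∀ x ∈ Icc α β, HasDerivAt g' (g'' x) x)
    (hg''c : ContinuousOn g'' (Icc α β))
    (hGb : ∀ x ∈ Icc α β, |g x| ≤ G) (hG1b : ∀ x ∈ Icc α β, |g' x| ≤ G₁) (hG2b : ∀ x ∈ Icc α β, |g'' x| ≤ G₂)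
    (hgα : g α = 0) (hgβ : g β = 0) :
    ‖∫ x in α..β, (g x : ℂ) * Complex.exp (I * P x)‖
      ≤ 2 * (G₁ / D ^ 2 + G * B₂ / D ^ 3)
        + (β - α) * (G₂ / D ^ 2 + 3 * G₁ * B₂ / D ^ 3 + G * B₃ / D ^ 3 + 3 * G * B₂ ^ 2 / D ^ 4) := by
  set E : ℝ → ℂ := fun x => Complex.exp (I * P x) with hE
  have hEn : ∀ x, ‖E x‖ = 1 := fun x => norm_exp_I_mul_ofReal (P x)
  have h0 : ∀ x ∈ Icc α β, P' x ≠ 0 := fun x hx h => by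
    have := hDb x hx; rw [h, abs_zero] at this; linarith
  have hgc : ContinuousOn g (Icc α β) := fun x hx => (hg x hx).continuousAt.continuousWithinAt
  have hg'c : ContinuousOn g' (Icc α β) := fun x hx => (hg' x hx).continuousAt.continuousWithinAt
  have hP'c : ContinuousOn P' (Icc α β) := fun x hx => (hP' x hx).continuousAt.continuousWithinAt
  have hP''c : ContinuousOn P'' (Icc α β) := fun x hx => (hP'' x hx).continuousAt.continuousWithinAt
  -- ### first integration by parts: boundary terms vanish
  have h1 := integral_amp_mul_exp_eq_parts hαβ hg hg'c hP hP' hP''c h0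
  rw [hgα, hgβ, zero_div, zero_div] at h1
  simp only [Complex.ofReal_zero, zero_mul, sub_zero, mul_zero, zero_add] at h1
  -- the new amplitude `g₂ = g'/P' - g P''/P'²` and its derivative
  set g₂ : ℝ → ℝ := fun x => g' x / P' x - g x * P'' x / (P' x) ^ 2 with hg₂
  set g₂' : ℝ → ℝ := fun x => g'' x / P' x - 2 * g' x * P'' x / (P' x) ^ 2 - g x * P''' x / (P' x) ^ 2
    + 2 * g x * (P'' x) ^ 2 / (P' x) ^ 3 with hg₂'
  have hg₂d : ∀ x ∈ Icc α β, HasDerivAt g₂ (g₂' x) x := by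
    intro x hx
    have hPx := h0 x hx
    have hd1 := (hg' x hx).div (hP' x hx) hPx
    have hd2 := ((hg x hx).mul (hP'' x hx)).div ((hP' x hx).fun_pow 2) (pow_ne_zero 2 hPx)
    have hd := hd1.sub hd2
    refine hd.congr_deriv ?_
    simp only [hg₂', Pi.mul_apply]
    field_simp
    ring
  have hg₂'c : ContinuousOn g₂' (Icc α β) := by
    rw [hg₂']
    have h2ne : ∀ x ∈ Icc α β, (P' x) ^ 2 ≠ 0 := fun x hx => pow_ne_zero 2 (h0 x hx)
    have h3ne : ∀ x ∈ Icc α β, (P' x) ^ 3 ≠ 0 := fun x hx => pow_ne_zero 3 (h0 x hx)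
    refine ((ContinuousOn.sub (ContinuousOn.sub (hg''c.div hP'c h0) ?_) ?_).add ?_)
    · exact ((continuousOn_const.mul hg'c).mul hP''c).div (hP'c.pow 2) h2ne
    · exact (hgc.mul hP'''c).div (hP'c.pow 2) h2ne
    · exact ((continuousOn_const.mul hgc).mul (hP''c.pow 2)).div (hP'c.pow 3) h3ne
  -- ### second integration by parts
  have h2 := integral_amp_mul_exp_eq_parts hαβ hg₂d hg₂'c hP hP' hP''c h0
  -- pointwise bounds
  have hDpow : ∀ x ∈ Icc α β, ∀ n : ℕ, D ^ n ≤ |P' x| ^ n := fun x hx n => pow_le_pow_left₀ hD.le (hDb x hx) n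
  have hg₂b : ∀ x ∈ Icc α β, |g₂ x| ≤ G₁ / D + G * B₂ / D ^ 2 := by
    intro x hx
    have hPa : 0 < |P' x| := hD.trans_le (hDb x hx)
    rw [hg₂]
    refine (abs_sub _ _).trans (add_le_add ?_ ?_)
    · rw [abs_div]; exact div_le_div₀ hG₁ (hG1b x hx) hD (hDb x hx)
    · rw [abs_div, abs_mul, abs_pow]
      exact div_le_div₀ (by positivity) (mul_le_mul (hGb x hx) (hB2 x hx) (abs_nonneg _) hG) (by positivity)
        (hDpow x hx 2)
  have hg₂'b : ∀ x ∈ Icc α β, |g₂' x| ≤ G₂ / D + 2 * G₁ * B₂ / D ^ 2 + G * B₃ / D ^ 2 + 2 * G * B₂ ^ 2 / D ^ 3 := by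
    intro x hx
    have hPa : 0 < |P' x| := hD.trans_le (hDb x hx)
    rw [hg₂']
    have e1 : |g'' x / P' x| ≤ G₂ / D := by
      rw [abs_div]; exact div_le_div₀ hG₂ (hG2b x hx) hD (hDb x hx)
    have e2 : |2 * g' x * P'' x / (P' x) ^ 2| ≤ 2 * G₁ * B₂ / D ^ 2 := by
      rw [abs_div, abs_mul, abs_mul, abs_pow, abs_two]
      exact div_le_div₀ (by positivity) (mul_le_mul (mul_le_mul_of_nonneg_left (hG1b x hx) (by norm_num))
        (hB2 x hx) (abs_nonneg _) (by positivity)) (by positivity) (hDpow x hx 2)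
    have e3 : |g x * P''' x / (P' x) ^ 2| ≤ G * B₃ / D ^ 2 := by
      rw [abs_div, abs_mul, abs_pow]
      exact div_le_div₀ (by positivity) (mul_le_mul (hGb x hx) (hB3 x hx) (abs_nonneg _) hG) (by positivity)
        (hDpow x hx 2)
    have e4 : |2 * g x * (P'' x) ^ 2 / (P' x) ^ 3| ≤ 2 * G * B₂ ^ 2 / D ^ 3 := by
      rw [abs_div, abs_mul, abs_mul, abs_pow, abs_pow, abs_two]
      refine div_le_div₀ (by positivity) ?_ (by positivity) (hDpow x hx 3)
      exact mul_le_mul (mul_le_mul_of_nonneg_left (hGb x hx) (by norm_num))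
        (pow_le_pow_left₀ (abs_nonneg _) (hB2 x hx) 2) (by positivity) (by positivity)
    calc |g'' x / P' x - 2 * g' x * P'' x / (P' x) ^ 2 - g x * P''' x / (P' x) ^ 2 + 2 * g x * (P'' x) ^ 2 / (P' x) ^ 3|
        ≤ |g'' x / P' x| + |2 * g' x * P'' x / (P' x) ^ 2| + |g x * P''' x / (P' x) ^ 2|
          + |2 * g x * (P'' x) ^ 2 / (P' x) ^ 3| := by
          have t1 := abs_add_le (g'' x / P' x - 2 * g' x * P'' x / (P' x) ^ 2 - g x * P''' x / (P' x) ^ 2)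
            (2 * g x * (P'' x) ^ 2 / (P' x) ^ 3)
          have t2 := abs_sub (g'' x / P' x - 2 * g' x * P'' x / (P' x) ^ 2) (g x * P''' x / (P' x) ^ 2)
          have t3 := abs_sub (g'' x / P' x) (2 * g' x * P'' x / (P' x) ^ 2)
          linarith
      _ ≤ _ := by linarith [e1, e2, e3, e4]
  -- the integrand of the second parts formula
  set K : ℝ := G₂ / D ^ 2 + 3 * G₁ * B₂ / D ^ 3 + G * B₃ / D ^ 3 + 3 * G * B₂ ^ 2 / D ^ 4 with hK
  have hintb : ∀ x ∈ Icc α β, ‖((g₂' x / P' x - g₂ x * P'' x / (P' x) ^ 2 : ℝ) : ℂ) * E x‖ ≤ K := by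
    intro x hx
    have hPa : 0 < |P' x| := hD.trans_le (hDb x hx)
    rw [norm_mul, hEn, mul_one, Complex.norm_real, Real.norm_eq_abs]
    have f1 : |g₂' x / P' x| ≤ (G₂ / D + 2 * G₁ * B₂ / D ^ 2 + G * B₃ / D ^ 2 + 2 * G * B₂ ^ 2 / D ^ 3) / D := by
      rw [abs_div]; exact div_le_div₀ (by positivity) (hg₂'b x hx) hD (hDb x hx)
    have f2 : |g₂ x * P'' x / (P' x) ^ 2| ≤ (G₁ / D + G * B₂ / D ^ 2) * B₂ / D ^ 2 := by
      rw [abs_div, abs_mul, abs_pow]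
      exact div_le_div₀ (by positivity) (mul_le_mul (hg₂b x hx) (hB2 x hx) (abs_nonneg _) (by positivity))
        (by positivity) (hDpow x hx 2)
    calc |g₂' x / P' x - g₂ x * P'' x / (P' x) ^ 2| ≤ |g₂' x / P' x| + |g₂ x * P'' x / (P' x) ^ 2| := abs_sub _ _
      _ ≤ (G₂ / D + 2 * G₁ * B₂ / D ^ 2 + G * B₃ / D ^ 2 + 2 * G * B₂ ^ 2 / D ^ 3) / D
          + (G₁ / D + G * B₂ / D ^ 2) * B₂ / D ^ 2 := add_le_add f1 f2
      _ = K := by rw [hK]; ring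
  have hbdry : ∀ x ∈ Icc α β, ‖((g₂ x / P' x : ℝ) : ℂ) * E x‖ ≤ G₁ / D ^ 2 + G * B₂ / D ^ 3 := by
    intro x hx
    have hPa : 0 < |P' x| := hD.trans_le (hDb x hx)
    rw [norm_mul, hEn, mul_one, Complex.norm_real, Real.norm_eq_abs, abs_div]
    calc |g₂ x| / |P' x| ≤ (G₁ / D + G * B₂ / D ^ 2) / D := div_le_div₀ (by positivity) (hg₂b x hx) hD (hDb x hx)
      _ = G₁ / D ^ 2 + G * B₂ / D ^ 3 := by ring
  -- ### assembly
  rw [h1, norm_mul, Complex.norm_I, one_mul, h2]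
  have hαI : α ∈ Icc α β := left_mem_Icc.2 hαβ
  have hβI : β ∈ Icc α β := right_mem_Icc.2 hαβ
  have hI2 : ‖∫ x in α..β, ((g₂' x / P' x - g₂ x * P'' x / (P' x) ^ 2 : ℝ) : ℂ) * E x‖ ≤ K * |β - α| :=
    intervalIntegral.norm_integral_le_of_norm_le_const fun x hx => hintb x
      (by rw [uIoc_of_le hαβ] at hx; exact ⟨hx.1.le, hx.2⟩)
  rw [abs_of_nonneg (sub_nonneg.2 hαβ)] at hI2
  calc ‖-I * (((g₂ β / P' β : ℝ) : ℂ) * E β - ((g₂ α / P' α : ℝ) : ℂ) * E α)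
        + I * ∫ x in α..β, ((g₂' x / P' x - g₂ x * P'' x / (P' x) ^ 2 : ℝ) : ℂ) * E x‖
      ≤ ‖((g₂ β / P' β : ℝ) : ℂ) * E β - ((g₂ α / P' α : ℝ) : ℂ) * E α‖
        + ‖∫ x in α..β, ((g₂' x / P' x - g₂ x * P'' x / (P' x) ^ 2 : ℝ) : ℂ) * E x‖ := by
        refine (norm_add_le _ _).trans (le_of_eq ?_)
        rw [norm_mul, norm_mul, norm_neg, Complex.norm_I, one_mul, one_mul]
    _ ≤ ((G₁ / D ^ 2 + G * B₂ / D ^ 3) + (G₁ / D ^ 2 + G * B₂ / D ^ 3)) + K * (β - α) :=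
        add_le_add ((norm_sub_le _ _).trans (add_le_add (hbdry β hβI) (hbdry α hαI))) hI2
    _ = 2 * (G₁ / D ^ 2 + G * B₂ / D ^ 3) + (β - α) * K := by ring

end Literature.Analysis.Fourier

end
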